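import Mathlib
import Literature.MathematicalPhysics.QuantumManyBody.BoseEinsteinCondensation
import Literature.MathematicalPhysics.QuantumManyBody.NeumannBoxParseval
import Summits.AtomisticToContinuum.BoseEinsteinCondensation.Theorems.SoloBlindModeOccupation
import Summits.AtomisticToContinuum.BoseEinsteinCondensation.Theorems.SoloBlindJastrowDensity

/-!
# Infrared form of the conditional BEC criterion: mode-occupation bounds imply condensation

Solo seat `solo-AtomisticToContinuum-blind`, conjunct `BoseEinsteinCondensation`.

With `N_k(Ψ) = (n+1) ∫ dY |⟨u_k, Ψ(·, Y)⟩|²` the occupation of the Neumann mode `u_k`, `k ∈ ℕ₀³`,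
of the box `Λ_L` in an `(n+1)`-boson Dirichlet trial state `Ψ` (see `SoloBlindModeOccupation`:
`∑_k N_k = n+1`, `∑_k (π/L)²|k|² N_k ≤ ∫|∇Ψ|²`, `∑_{k ∈ {0,…,M}³} 1/|k| ≤ 7M²`) we prove:

* `sub_le_modeOccupation_zero` : if `N_k(Ψ) ≤ A/|k|` for all `0 ≠ k ∈ {0,…,M}³` (an *infrared
  bound* on the low modes) and `∫|∇Ψ|² ≤ T`, then `N_0(Ψ) ≥ (n+1) - 7 A M² - T · (L/(π(M+1)))²`;
* `modeOccupation_zero_le_maxOccupation` : `N_0(Ψ) ≤ λ_max(γ_Ψ)` (the flat mode is admissible);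
* `hasGroundStateBEC_of_infrared_bound` : if such bounds hold along the near-minimisers for all
  large `N` with `7 A M² + T (L/(π(M+1)))² ≤ η N`, `η < 1`, then `HasGroundStateBEC v ρ` with
  condensate fraction `≥ 1 - η`.

This is the form in which an infrared bound `n_k ≲ 1/|k|` on the momentum distribution of
(near-)ground states — for instance the one that follows, on the torus, from a Landau-type lower
bound on the momentum-sector excitation energies of the `N ± 1`-particle systems via the one-body
`f`-sum rule — implies Bose–Einstein condensation in three dimensions (and fails to do so in lower
dimension, where `∑_{|k| ≤ M} 1/|k|` outgrows the number `M^d` of modes below the cutoff).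
-/

noncomputable section

open MeasureTheory Filter Set
open scoped ENNReal NNReal Real

namespace Summit.AtomisticToContinuum.BoseEinsteinCondensation.Theorems

open Literature.MathematicalPhysics.QuantumManyBody.BoseGas
open Literature.MathematicalPhysics.QuantumManyBody.NeumannBox

/-! ### The infrared criterion -/

section Criterion

variable {n : ℕ} {L : ℝ}

/-- **The infrared criterion (one trial state).**  If the low Neumann modes `0 ≠ k ∈ {0,…,M}³`
carry occupation `N_k(Ψ) ≤ A/|k|` and `∫|∇Ψ|² ≤ T`, then the flat mode carries
`N_0(Ψ) ≥ (n+1) - 7AM² - T (L/(π(M+1)))²`. -/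
theorem sub_le_modeOccupation_zero (hL : 0 < L) (Ψ : TrialState (n + 1) L) (M : ℕ)
    (A T : ℝ≥0∞) (hT : ∫⁻ X, kineticDensity Ψ.ψ X ≤ T)
    (hIR : ∀ k : Fin 3 → ℕ, k ≠ 0 → (∀ i, k i ≤ M) →
      (n + 1 : ℝ≥0∞) * ∫⁻ Y : Config n,
          ‖∫ x in box L, (mode L k x : ℂ) * Ψ.ψ (Matrix.vecCons x Y)‖ₑ ^ 2 ≤
        A / ENNReal.ofReal (Real.sqrt (∑ i, (k i : ℝ) ^ 2))) :
    (n + 1 : ℝ≥0∞) - (7 * A * (M : ℝ≥0∞) ^ 2 + T * ENNReal.ofReal ((L / (π * (M + 1))) ^ 2)) ≤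
      (n + 1 : ℝ≥0∞) * ∫⁻ Y : Config n,
        ‖∫ x in box L, (mode L 0 x : ℂ) * Ψ.ψ (Matrix.vecCons x Y)‖ₑ ^ 2 := by
  set nocc : (Fin 3 → ℕ) → ℝ≥0∞ := fun k => (n + 1 : ℝ≥0∞) * ∫⁻ Y : Config n,
      ‖∫ x in box L, (mode L k x : ℂ) * Ψ.ψ (Matrix.vecCons x Y)‖ₑ ^ 2 with hnocc
  change _ - _ ≤ nocc 0
  set C : Finset (Fin 3 → ℕ) := Fintype.piFinset fun _ : Fin 3 => Finset.range (M + 1) with hC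
  have hmemC : ∀ k : Fin 3 → ℕ, k ∈ C ↔ ∀ i, k i ≤ M := by
    intro k
    simp [hC, Fintype.mem_piFinset, Finset.mem_range]
  have h0C : (0 : Fin 3 → ℕ) ∈ C := (hmemC 0).2 fun _ => by simp
  have htot : ∑' k, nocc k = (n + 1 : ℝ≥0∞) := tsum_modeOccupation_eq hL Ψ
  have hsplit : ∑' k, nocc k =
      nocc 0 + ∑ k ∈ C.erase 0, nocc k + ∑' k : ↥((C : Set (Fin 3 → ℕ))ᶜ), nocc k := by
    rw [← ENNReal.sum_add_tsum_compl C, ← Finset.add_sum_erase C nocc h0C]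
  -- the low modes
  have hlow : ∑ k ∈ C.erase 0, nocc k ≤ 7 * A * (M : ℝ≥0∞) ^ 2 := by
    calc ∑ k ∈ C.erase 0, nocc k
        ≤ ∑ k ∈ C.erase 0, A * ENNReal.ofReal (1 / Real.sqrt (∑ i, (k i : ℝ) ^ 2)) := by
          refine Finset.sum_le_sum fun k hk => ?_
          rw [Finset.mem_erase] at hk
          have hk0 : k ≠ 0 := hk.1
          have hpos : 0 < Real.sqrt (∑ i, (k i : ℝ) ^ 2) := by
            obtain ⟨i, hi⟩ : ∃ i, k i ≠ 0 := by
              by_contra hcon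
              push Not at hcon
              exact hk0 (funext hcon)
            apply Real.sqrt_pos.2
            calc (0 : ℝ) < (k i : ℝ) ^ 2 := by positivity
              _ ≤ ∑ j, (k j : ℝ) ^ 2 := Finset.single_le_sum (f := fun j => (k j : ℝ) ^ 2)
                  (fun j _ => sq_nonneg _) (Finset.mem_univ i)
          calc nocc k ≤ A / ENNReal.ofReal (Real.sqrt (∑ i, (k i : ℝ) ^ 2)) :=
                hIR k hk0 ((hmemC k).1 hk.2)
            _ = A * ENNReal.ofReal (1 / Real.sqrt (∑ i, (k i : ℝ) ^ 2)) := by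
                rw [div_eq_mul_inv, one_div, ENNReal.ofReal_inv_of_pos hpos]
      _ = A * ENNReal.ofReal (∑ k ∈ C.erase 0, 1 / Real.sqrt (∑ i, (k i : ℝ) ^ 2)) := by
          rw [← Finset.mul_sum, ENNReal.ofReal_sum_of_nonneg fun k _ => by positivity]
      _ ≤ A * ENNReal.ofReal (7 * (M : ℝ) ^ 2) := by
          gcongr
          calc ∑ k ∈ C.erase 0, 1 / Real.sqrt (∑ i, (k i : ℝ) ^ 2)
              ≤ ∑ k ∈ C, 1 / Real.sqrt (∑ i, (k i : ℝ) ^ 2) :=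
                Finset.sum_le_sum_of_subset_of_nonneg (Finset.erase_subset 0 C)
                  fun k _ _ => by positivity
            _ ≤ 7 * (M : ℝ) ^ 2 := sum_inv_norm_le M
      _ = 7 * A * (M : ℝ≥0∞) ^ 2 := by
          rw [show (7 : ℝ) * (M : ℝ) ^ 2 = ((7 * M ^ 2 : ℕ) : ℝ) by push_cast; ring,
            ENNReal.ofReal_natCast]
          push_cast
          ring
  -- the high modes
  have hΛ0 : 0 < (π * ((M : ℝ) + 1) / L) ^ 2 := by positivity
  have hkey : ∀ k : Fin 3 → ℕ, k ∈ ((C : Set (Fin 3 → ℕ))ᶜ) →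
      nocc k ≤ (ENNReal.ofReal ((π * ((M : ℝ) + 1) / L) ^ 2))⁻¹ *
        (ENNReal.ofReal (∑ i, waveNumber L (k i) ^ 2) * nocc k) := by
    intro k hk
    rw [Set.mem_compl_iff, Finset.mem_coe, hmemC] at hk
    push Not at hk
    obtain ⟨i, hi⟩ := hk
    have hi' : (M : ℝ) + 1 ≤ (k i : ℝ) := by exact_mod_cast hi
    have hle : (π * ((M : ℝ) + 1) / L) ^ 2 ≤ ∑ j, waveNumber L (k j) ^ 2 := by
      calc (π * ((M : ℝ) + 1) / L) ^ 2 ≤ waveNumber L (k i) ^ 2 := by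
            rw [waveNumber, mul_comm ((k i : ℕ) : ℝ) π]
            gcongr
        _ ≤ ∑ j, waveNumber L (k j) ^ 2 := Finset.single_le_sum
            (f := fun j => waveNumber L (k j) ^ 2) (fun j _ => sq_nonneg _) (Finset.mem_univ i)
    calc nocc k = (ENNReal.ofReal ((π * ((M : ℝ) + 1) / L) ^ 2))⁻¹ *
          (ENNReal.ofReal ((π * ((M : ℝ) + 1) / L) ^ 2) * nocc k) := by
          rw [← mul_assoc, ENNReal.inv_mul_cancel (ENNReal.ofReal_pos.2 hΛ0).ne'
            ENNReal.ofReal_ne_top, one_mul]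
      _ ≤ (ENNReal.ofReal ((π * ((M : ℝ) + 1) / L) ^ 2))⁻¹ *
          (ENNReal.ofReal (∑ j, waveNumber L (k j) ^ 2) * nocc k) := by
          gcongr
  have htail : ∑' k : ↥((C : Set (Fin 3 → ℕ))ᶜ), nocc k ≤
      T * ENNReal.ofReal ((L / (π * (M + 1))) ^ 2) := by
    calc ∑' k : ↥((C : Set (Fin 3 → ℕ))ᶜ), nocc k
        ≤ ∑' k : ↥((C : Set (Fin 3 → ℕ))ᶜ), (ENNReal.ofReal ((π * ((M : ℝ) + 1) / L) ^ 2))⁻¹ *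
            (ENNReal.ofReal (∑ i, waveNumber L ((k : Fin 3 → ℕ) i) ^ 2) * nocc k) :=
          ENNReal.tsum_le_tsum fun k => hkey k k.2
      _ ≤ (ENNReal.ofReal ((π * ((M : ℝ) + 1) / L) ^ 2))⁻¹ *
            ∑' k : Fin 3 → ℕ, ENNReal.ofReal (∑ i, waveNumber L (k i) ^ 2) * nocc k := by
          rw [ENNReal.tsum_mul_left]
          gcongr
          exact ENNReal.tsum_comp_le_tsum_of_injective Subtype.val_injective
            (fun k : Fin 3 → ℕ => ENNReal.ofReal (∑ i, waveNumber L (k i) ^ 2) * nocc k)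
      _ ≤ (ENNReal.ofReal ((π * ((M : ℝ) + 1) / L) ^ 2))⁻¹ * T := by
          gcongr
          exact (tsum_waveNumber_sq_mul_modeOccupation_le hL Ψ).trans hT
      _ = T * ENNReal.ofReal ((L / (π * (M + 1))) ^ 2) := by
          rw [mul_comm, ← ENNReal.ofReal_inv_of_pos hΛ0, ← inv_pow, inv_div]
  -- assemble
  rw [tsub_le_iff_right]
  calc (n + 1 : ℝ≥0∞) = ∑' k, nocc k := htot.symm
    _ = nocc 0 + (∑ k ∈ C.erase 0, nocc k + ∑' k : ↥((C : Set (Fin 3 → ℕ))ᶜ), nocc k) := by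
        rw [hsplit, add_assoc]
    _ ≤ nocc 0 + (7 * A * (M : ℝ≥0∞) ^ 2 + T * ENNReal.ofReal ((L / (π * (M + 1))) ^ 2)) :=
        add_le_add le_rfl (add_le_add hlow htail)

/-- **The flat mode is an admissible condensate wave function**: `N_0(Ψ) ≤ λ_max(γ_Ψ)`. -/
theorem modeOccupation_zero_le_maxOccupation (hL : 0 < L) (Ψ : TrialState (n + 1) L) :
    (n + 1 : ℝ≥0∞) * ∫⁻ Y : Config n,
        ‖∫ x in box L, (mode L 0 x : ℂ) * Ψ.ψ (Matrix.vecCons x Y)‖ₑ ^ 2 ≤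
      maxOccupation (n + 1) Ψ.ψ := by
  have hS : MeasurableSet (box L) := by
    rw [box_eq_preimage]
    exact (MeasurableSet.univ_pi fun _ => measurableSet_Ioo).preimage
      (PiLp.volume_preserving_ofLp (Fin 3)).measurable
  set c : ℝ := (1 / Real.sqrt L) ^ 3 with hc
  have hc0 : 0 ≤ c := by positivity
  have hc2 : c ^ 2 * L ^ 3 = 1 := by
    rw [hc, ← pow_mul, show 3 * 2 = 2 * 3 by norm_num, pow_mul, div_pow, one_pow,
      Real.sq_sqrt hL.le]
    field_simp
  have hφm : AEStronglyMeasurable (fun x : Space => (box L).indicator (fun _ => (c : ℂ)) x)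
      volume :=
    aestronglyMeasurable_const.indicator hS
  have hφ1 : ∫⁻ x, (‖(box L).indicator (fun _ => (c : ℂ)) x‖₊ : ℝ≥0∞) ^ 2 = 1 := by
    have hpt : (fun x : Space => (‖(box L).indicator (fun _ => (c : ℂ)) x‖₊ : ℝ≥0∞) ^ 2) =
        (box L).indicator (fun _ => ENNReal.ofReal (c ^ 2)) := by
      funext x
      by_cases hx : x ∈ box L
      · rw [Set.indicator_of_mem hx, Set.indicator_of_mem hx, ← enorm_eq_nnnorm, ← ofReal_norm,
          Complex.norm_real, Real.norm_of_nonneg hc0, ← ENNReal.ofReal_pow hc0]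
      · rw [Set.indicator_of_notMem hx, Set.indicator_of_notMem hx]
        simp
    rw [hpt, lintegral_indicator_const hS, volume_box, ← ENNReal.ofReal_pow hL.le,
      ← ENNReal.ofReal_mul (sq_nonneg c), hc2, ENNReal.ofReal_one]
  have hocc : occupation (n + 1) (fun x : Space => (box L).indicator (fun _ => (c : ℂ)) x) Ψ.ψ =
      (n + 1 : ℝ≥0∞) * ∫⁻ Y : Config n,
        ‖∫ x in box L, (mode L 0 x : ℂ) * Ψ.ψ (Matrix.vecCons x Y)‖ₑ ^ 2 := by
    simp only [occupation]
    congr 1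
    refine lintegral_congr fun Y => ?_
    have hint : (fun x : Space => (starRingEnd ℂ) ((box L).indicator (fun _ => (c : ℂ)) x) *
        Ψ.ψ (Matrix.vecCons x Y)) =
        (box L).indicator (fun x => (mode L 0 x : ℂ) * Ψ.ψ (Matrix.vecCons x Y)) := by
      funext x
      by_cases hx : x ∈ box L
      · rw [Set.indicator_of_mem hx, Set.indicator_of_mem hx, mode_zero, Complex.conj_ofReal]
      · rw [Set.indicator_of_notMem hx, Set.indicator_of_notMem hx, map_zero, zero_mul]
    rw [hint, integral_indicator hS, enorm_eq_nnnorm]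
  rw [← hocc]
  exact occupation_le_maxOccupation Ψ.ψ hφm hφ1

/-- **Infrared bounds along the near-minimisers imply Bose–Einstein condensation.**
If for all large `N = n+1` there are `δ > 0`, a mode cutoff `M` and budgets `A, T` with
`7AM² + T (L/(π(M+1)))² ≤ η N` (`L = (N/ρ)^{1/3}`, `η < 1` fixed) such that every `N`-particle
trial state of energy `≤ E₀ + δ` has kinetic energy `≤ T` and low-mode occupations
`N_k(Ψ) ≤ A/|k|` (`0 ≠ k ∈ {0,…,M}³`), then `HasGroundStateBEC v ρ` holds with condensate fraction
`1 - η`. -/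
theorem hasGroundStateBEC_of_infrared_bound (v : ℝ → ℝ≥0∞) {ρ : ℝ} (hρ : 0 < ρ) {η : ℝ≥0∞}
    (hη : η < 1)
    (h : ∀ᶠ n : ℕ in atTop, ∃ δ : ℝ≥0∞, 0 < δ ∧ ∃ (M : ℕ) (A T : ℝ≥0∞),
      7 * A * (M : ℝ≥0∞) ^ 2 +
          T * ENNReal.ofReal ((sideLength ρ (n + 1) / (π * (M + 1))) ^ 2) ≤ η * (n + 1) ∧
      ∀ Ψ : TrialState (n + 1) (sideLength ρ (n + 1)),
        energy v Ψ ≤ groundStateEnergy v (n + 1) (sideLength ρ (n + 1)) + δ →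
        ∫⁻ X, kineticDensity Ψ.ψ X ≤ T ∧
        ∀ k : Fin 3 → ℕ, k ≠ 0 → (∀ i, k i ≤ M) →
          (n + 1 : ℝ≥0∞) * ∫⁻ Y : Config n, ‖∫ x in box (sideLength ρ (n + 1)),
              (mode (sideLength ρ (n + 1)) k x : ℂ) * Ψ.ψ (Matrix.vecCons x Y)‖ₑ ^ 2 ≤
            A / ENNReal.ofReal (Real.sqrt (∑ i, (k i : ℝ) ^ 2))) :
    HasGroundStateBEC v ρ := by
  have h1η : 1 - η ≠ ∞ := ne_top_of_le_ne_top ENNReal.one_ne_top tsub_le_self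
  refine ⟨(1 - η).toReal, ENNReal.toReal_pos (tsub_pos_of_lt hη).ne' h1η, ?_⟩
  rw [Filter.eventually_atTop] at h ⊢
  obtain ⟨n₀, hn₀⟩ := h
  refine ⟨n₀ + 1, fun N hN => ?_⟩
  obtain ⟨n, rfl⟩ : ∃ n, N = n + 1 := ⟨N - 1, by omega⟩
  obtain ⟨δ, hδ, M, A, T, harith, hΨ⟩ := hn₀ n (by omega)
  have hNpos : (0 : ℝ) < ((n + 1 : ℕ) : ℝ) := by exact_mod_cast Nat.succ_pos n
  have hL : 0 < sideLength ρ (n + 1) := by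
    rw [sideLength]
    exact Real.rpow_pos_of_pos (div_pos hNpos hρ) _
  refine le_condensateNumber v hδ fun Ψ hE => ?_
  obtain ⟨hT, hIR⟩ := hΨ Ψ hE
  calc ENNReal.ofReal ((1 - η).toReal * ((n + 1 : ℕ) : ℝ))
      = (1 - η) * (n + 1 : ℝ≥0∞) := by
        rw [ENNReal.ofReal_mul ENNReal.toReal_nonneg, ENNReal.ofReal_toReal h1η,
          ENNReal.ofReal_natCast]
        push_cast
        ring
    _ = (n + 1 : ℝ≥0∞) - η * (n + 1) := by
        rw [ENNReal.sub_mul fun _ _ => by exact_mod_cast ENNReal.natCast_ne_top (n + 1), one_mul]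
    _ ≤ (n + 1 : ℝ≥0∞) - (7 * A * (M : ℝ≥0∞) ^ 2 +
          T * ENNReal.ofReal ((sideLength ρ (n + 1) / (π * (M + 1))) ^ 2)) :=
        tsub_le_tsub_left harith _
    _ ≤ (n + 1 : ℝ≥0∞) * ∫⁻ Y : Config n, ‖∫ x in box (sideLength ρ (n + 1)),
          (mode (sideLength ρ (n + 1)) 0 x : ℂ) * Ψ.ψ (Matrix.vecCons x Y)‖ₑ ^ 2 :=
        sub_le_modeOccupation_zero hL Ψ M A T hT hIR
    _ ≤ maxOccupation (n + 1) Ψ.ψ := modeOccupation_zero_le_maxOccupation hL Ψ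

end Criterion

end Summit.AtomisticToContinuum.BoseEinsteinCondensation.Theorems

end
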